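import Literature.AlgebraicGeometry.Resolution.RegularQuotientIdeal
import Literature.AlgebraicGeometry.Resolution.JacobianCriterion
import Literature.AlgebraicGeometry.Resolution.RegularLocalRingsQuotient
import HarnessLib

/-!
# [OURS · L1 W4.5(b) · EL♮(3)] T-LIFT-CI, part 1 (RING CORE): a complete intersection over a local base whose special fibre is
# cut out by elements with independent differentials is REGULAR with the uniformiser a NON-ZERO-DIVISOR («cotangent lift»)

Cell `res-hironaka`, rung L, slot W4.5(b); crux **EL♮(3) = `Theses.EquisingularLift.EquisingularLiftNatThree`**
(stmt-ResolutionOfSingularities-20148), registered stub `stub_elnat_three_nonisolated` (child line `sections3`); CUT (L1) T-LIFT-CI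
of res-D-pv-027 AS res-L1-s36-pv-4 (STATUS 2026-08-27T08:47:30Z, ENDORSED by res-L1-w45b-lead-2 08:48:39Z; keyed to lead-2's
TARGET-CINOSE 9810b78bf486e457). OURS; NOT a statement of any manuscript; AI-written, weaker than expert review. No definition, no
`sorry`, standard axioms. Filed `--supports stmt-ResolutionOfSingularities-20148 --as helper`.

WHAT IT IS FOR. The smooth-complete-intersection NOSE `C = V₊(F̃₁,…,F̃_c) ⊂ ℙⁿ_O` (any homogeneous lifts `F̃_i` of forms `f_i`
cutting out a SMOOTH `Σ = V₊(f) ⊂ ℙⁿ_k` of codimension `c`) must be REGULAR and `O`-FLAT for the item's E1-chain step. On a chart,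
at a point of the special fibre, this is the following local algebra (part 2 does the `Proj` packaging, part 3 the `Smooth` upgrade).

SETTING. `(S, 𝔪)` a local ring, `ϖ ∈ 𝔪` (the uniformiser of the base, seen in `S`), `F : Fin c → 𝔪` (germs of the lifts).
DOWNSTAIRS HYPOTHESIS (ring-level form of «`f̄₁,…,f̄_c` have linearly independent differentials in the cotangent space of
`S̄ = S/ϖS`»): `∀ a, Σ aᵢ Fᵢ ∈ 𝔪² + (ϖ) → ∀ i, aᵢ ∈ 𝔪` — exactly what the Jacobian-minor clause gives on `S̄ = k[y]_𝔭`
(tree `JacobianCriterion.coeff_mem_maximalIdeal_of_sum_mul_mem_sq`), transported by `downstairs_of_surjective`.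

* §1 `forall_mem_maximalIdeal_of_sum_cons_mem_sq` / `linearIndependent_toCotangent_cons` — **cotangent lift**: if moreover `ϖ ∉ 𝔪²`
  then `(ϖ, F₁, …, F_c)` has linearly independent differentials in `𝔪/𝔪²` (ring-level and `toCotangent` forms).
* §2 (`S` REGULAR local) `isRegularLocalRing_quotient_span_image` (the quotient by any subfamily of a cotangent-independent family is a
  regular local ring — the regularity half of tree `isPrime_span_image_of_linearIndependent_toCotangent`, exported),
  `isRegularLocalRing_quotient_span_range_tail` (`S/(F)` regular), `isPrime_span_range_tail`, `not_mem_span_range_tail` (`ϖ ∉ (F)`),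
  `mem_span_range_of_mul_mem` / **`mk_mem_nonZeroDivisors_of_cons`** (`ϖ` is a non-zero-divisor of `S/(F)` — the `O`-FLATNESS of the nose at the point),
  `isRegularLocalRing_quotient_span_range_cons` (`S/((F) + (ϖ))` regular — its special fibre).
* §3 `downstairs_of_surjective` — transport of the downstairs hypothesis along a local surjection `q : S ↠ A` killing `ϖ`
  (`A ≅ S/ϖS`, e.g. `k[y]_𝔭`); `downstairs_of_jacobian` — the Jacobian-minor supply on `A = R_P` (Matsumura 30.4 (ii) key step).

References: Matsumura, *Commutative Ring Theory* (1986), Thms. 14.2, 14.3, 30.4 (ii) [Matsumura1987]; cell: CHAIN w45b v7.4.1,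
CRUX-PLAN v3.1 (LIFT supply), TARGET-CINOSE (lead-2).
-/

set_option linter.dupNamespace false -- mandated namespace `Summit.<Summit>.<Problem>` of this single-conjunct summit

noncomputable section

namespace Summit.ResolutionOfSingularities.ResolutionOfSingularities.Cruxes.EquisingularLiftNat.Sections

namespace CILift

open IsLocalRing Literature.AlgebraicGeometry.Resolution

universe u v

variable {S : Type u} [CommRing S] [IsLocalRing S]

/-! ## §1 The cotangent lift -/

/-- Members of `(ϖ, F₁, …, F_c)` lie in `𝔪`. [folklore] -/
theorem cons_mem_maximalIdeal {c : ℕ} {ϖ : S} (hϖ : ϖ ∈ maximalIdeal S) {F : Fin c → S}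
    (hF : ∀ i, F i ∈ maximalIdeal S) (i : Fin (c + 1)) : (Fin.cons ϖ F : Fin (c + 1) → S) i ∈ maximalIdeal S := by
  refine Fin.cases ?_ (fun j => ?_) i
  · simpa using hϖ
  · simpa using hF j

/-- **Cotangent lift, ring level.** If `ϖ ∉ 𝔪²`, `Fᵢ ∈ 𝔪`, and `Σ aᵢ Fᵢ ∈ 𝔪² + (ϖ)` forces all `aᵢ ∈ 𝔪` (independence of the
differentials DOWNSTAIRS, in `S/ϖS`), then `a₀ ϖ + Σ aᵢ Fᵢ ∈ 𝔪²` forces `a₀ ∈ 𝔪` and all `aᵢ ∈ 𝔪` (independence UPSTAIRS).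
[cite: Matsumura1987, Thm. 14.2 (regular systems of parameters modulo 𝔪²)] -/
theorem forall_mem_maximalIdeal_of_sum_cons_mem_sq {c : ℕ} {ϖ : S} (hϖ2 : ϖ ∉ maximalIdeal S ^ 2) {F : Fin c → S}
    (hF : ∀ i, F i ∈ maximalIdeal S)
    (hdown : ∀ a : Fin c → S, ∑ i, a i * F i ∈ maximalIdeal S ^ 2 ⊔ Ideal.span {ϖ} → ∀ i, a i ∈ maximalIdeal S)
    (a : Fin (c + 1) → S) (ha : ∑ i, a i * (Fin.cons ϖ F : Fin (c + 1) → S) i ∈ maximalIdeal S ^ 2) :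
    ∀ i, a i ∈ maximalIdeal S := by
  rw [Fin.sum_univ_succ] at ha
  simp only [Fin.cons_zero, Fin.cons_succ] at ha
  -- the tail: reduce modulo `ϖ`
  have htail : ∀ i, a (Fin.succ i) ∈ maximalIdeal S := by
    refine hdown (fun i => a i.succ) ?_
    have h : ∑ i, a i.succ * F i = (a 0 * ϖ + ∑ i, a i.succ * F i) - a 0 * ϖ := by ring
    rw [h]
    exact sub_mem (Ideal.mem_sup_left ha)
      (Ideal.mem_sup_right (Ideal.mul_mem_left _ _ (Ideal.mem_span_singleton_self ϖ)))
  have hsum : ∑ i, a i.succ * F i ∈ maximalIdeal S ^ 2 :=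
    Ideal.sum_mem _ fun i _ => by
      rw [pow_two]
      exact Ideal.mul_mem_mul (htail i) (hF i)
  have h0 : a 0 * ϖ ∈ maximalIdeal S ^ 2 := by
    have h := sub_mem ha hsum
    rwa [add_sub_cancel_right] at h
  have ha0 : a 0 ∈ maximalIdeal S := by
    by_contra h
    have hu : IsUnit (a 0) := by simpa [mem_maximalIdeal, mem_nonunits_iff] using h
    apply hϖ2
    have : ϖ = ↑hu.unit⁻¹ * (a 0 * ϖ) := by
      rw [← mul_assoc, IsUnit.val_inv_mul, one_mul]
    rw [this]
    exact Ideal.mul_mem_left _ _ h0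
  intro i
  exact Fin.cases ha0 (fun j => htail j) i

/-- **Cotangent lift, `toCotangent` form**: under the same hypotheses (and `ϖ ∈ 𝔪`) the family `(ϖ, F₁, …, F_c)` has linearly
independent images in `𝔪/𝔪²`. [cite: Matsumura1987, Thm. 14.2] -/
theorem linearIndependent_toCotangent_cons {c : ℕ} {ϖ : S} (hϖ : ϖ ∈ maximalIdeal S) (hϖ2 : ϖ ∉ maximalIdeal S ^ 2)
    {F : Fin c → S} (hF : ∀ i, F i ∈ maximalIdeal S)
    (hdown : ∀ a : Fin c → S, ∑ i, a i * F i ∈ maximalIdeal S ^ 2 ⊔ Ideal.span {ϖ} → ∀ i, a i ∈ maximalIdeal S) :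
    LinearIndependent (ResidueField S)
      fun i => (maximalIdeal S).toCotangent ⟨(Fin.cons ϖ F : Fin (c + 1) → S) i, cons_mem_maximalIdeal hϖ hF i⟩ :=
  linearIndependent_toCotangent_of_forall_family _ (cons_mem_maximalIdeal hϖ hF)
    (forall_mem_maximalIdeal_of_sum_cons_mem_sq hϖ2 hF hdown)

/-! ## §2 Consequences in a REGULAR local ring: `S/(F)` regular, `(F)` prime, `ϖ` a non-zero-divisor modulo `(F)` -/

section Regular

variable {R : Type u} [CommRing R] [IsRegularLocalRing R] {c : ℕ} (f : Fin c → R) (hf : ∀ i, f i ∈ maximalIdeal R)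
  (hli : LinearIndependent (ResidueField R) fun i => (maximalIdeal R).toCotangent ⟨f i, hf i⟩)

include hli in
/-- **The quotient of a regular local ring by any subfamily of a cotangent-independent family is a regular local ring**
(Matsumura 14.2; the regularity half of tree `isPrime_span_image_of_linearIndependent_toCotangent`, exported).
[cite: Matsumura1987, Thm. 14.2] -/
theorem isRegularLocalRing_quotient_span_image (T : Set (Fin c)) :
    IsRegularLocalRing (R ⧸ Ideal.span (f '' T)) := by
  classical
  haveI : Fintype T := Fintype.ofFinite _
  set s : Finset R := (Finset.univ : Finset T).image (fun t : T => f (t : Fin c)) with hs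
  have hsT : (s : Set R) = f '' T := by
    ext y
    simp only [hs, Finset.coe_image, Finset.coe_univ, Set.image_univ, Set.mem_range, Set.mem_image]
    constructor
    · rintro ⟨t, rfl⟩; exact ⟨t, t.2, rfl⟩
    · rintro ⟨j, hj, rfl⟩; exact ⟨⟨j, hj⟩, rfl⟩
  have hsm : (s : Set R) ⊆ maximalIdeal R := by
    rw [hsT]; rintro _ ⟨j, -, rfl⟩; exact hf j
  have hli' : LinearIndependent (ResidueField R) (fun x : s => (maximalIdeal R).toCotangent ⟨x, hsm x.2⟩) := by
    have hex : ∀ x : s, ∃ t : T, f t = x := fun x => by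
      have hx := x.2
      rw [← Finset.mem_coe, hsT] at hx
      obtain ⟨j, hj, hjx⟩ := hx
      exact ⟨⟨j, hj⟩, hjx⟩
    choose e he using hex
    have heinj : Function.Injective (fun x : s => ((e x : T) : Fin c)) := by
      intro x y hxy
      apply Subtype.ext
      rw [← he x, ← he y]
      exact congrArg f hxy
    have := hli.comp _ heinj
    convert this using 1
    funext x
    simp only [Function.comp, he x]
  have h := isRegularLocalRing_quotient_span s hsm hli'
  rwa [hsT] at h

end Regular

section RegularCons

variable {R : Type u} [CommRing R] [IsRegularLocalRing R] {c : ℕ} {ϖ : R} (hϖ : ϖ ∈ maximalIdeal R)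
  (hϖ2 : ϖ ∉ maximalIdeal R ^ 2) {F : Fin c → R} (hF : ∀ i, F i ∈ maximalIdeal R)
  (hdown : ∀ a : Fin c → R, ∑ i, a i * F i ∈ maximalIdeal R ^ 2 ⊔ Ideal.span {ϖ} → ∀ i, a i ∈ maximalIdeal R)

omit [CommRing R] [IsRegularLocalRing R] in
/-- `(ϖ, F) '' {successors} = range F`. Plumbing. [folklore] -/
theorem image_cons_range_succ : (Fin.cons ϖ F : Fin (c + 1) → R) '' Set.range Fin.succ = Set.range F := by
  ext y
  constructor
  · rintro ⟨_, ⟨j, rfl⟩, rfl⟩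
    exact ⟨j, by simp⟩
  · rintro ⟨j, rfl⟩
    exact ⟨j.succ, ⟨j, rfl⟩, by simp⟩

omit [IsRegularLocalRing R] in
/-- `(ϖ, F) '' univ`, as an ideal: `(F) + (ϖ)`. Plumbing. [folklore] -/
theorem span_image_cons_univ :
    Ideal.span ((Fin.cons ϖ F : Fin (c + 1) → R) '' Set.univ) = Ideal.span (Set.range F) ⊔ Ideal.span {ϖ} := by
  rw [Set.image_univ, Fin.range_cons, Set.insert_eq, Ideal.span_union, sup_comm]

include hϖ hϖ2 hF hdown in
/-- **`S/(F₁,…,F_c)` is a regular local ring.** [cite: Matsumura1987, Thm. 14.2] -/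
theorem isRegularLocalRing_quotient_span_range_tail : IsRegularLocalRing (R ⧸ Ideal.span (Set.range F)) := by
  have h := isRegularLocalRing_quotient_span_image _ (cons_mem_maximalIdeal hϖ hF)
    (linearIndependent_toCotangent_cons hϖ hϖ2 hF hdown) (Set.range Fin.succ)
  rwa [image_cons_range_succ] at h

include hϖ hϖ2 hF hdown in
/-- **`S/((F₁,…,F_c) + (ϖ))` — the special fibre of the nose at the point — is a regular local ring.**
[cite: Matsumura1987, Thm. 14.2] -/
theorem isRegularLocalRing_quotient_span_range_cons :
    IsRegularLocalRing (R ⧸ (Ideal.span (Set.range F) ⊔ Ideal.span {ϖ})) := by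
  have h := isRegularLocalRing_quotient_span_image _ (cons_mem_maximalIdeal hϖ hF)
    (linearIndependent_toCotangent_cons hϖ hϖ2 hF hdown) Set.univ
  rwa [span_image_cons_univ] at h

include hϖ hϖ2 hF hdown in
/-- **`(F₁,…,F_c)` is a prime ideal** (regular local rings are domains, Matsumura 14.3). [cite: Matsumura1987, Thm. 14.3] -/
theorem isPrime_span_range_tail : (Ideal.span (Set.range F)).IsPrime := by
  have h := isPrime_span_image_of_linearIndependent_toCotangent _ (cons_mem_maximalIdeal hϖ hF)
    (linearIndependent_toCotangent_cons hϖ hϖ2 hF hdown) (Set.range Fin.succ)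
  rwa [image_cons_range_succ] at h

include hϖ hϖ2 hF hdown in
/-- **`ϖ ∉ (F₁,…,F_c)`** — the nose is not contained in the special fibre at the point. [cite: Matsumura1987, Thm. 14.2] -/
theorem not_mem_span_range_tail : ϖ ∉ Ideal.span (Set.range F) := by
  have h := not_mem_span_image_of_linearIndependent_toCotangent _ (cons_mem_maximalIdeal hϖ hF)
    (linearIndependent_toCotangent_cons hϖ hϖ2 hF hdown) 0 (Set.range Fin.succ)
    (by rintro ⟨j, hj⟩; exact Fin.succ_ne_zero j hj)
  rwa [image_cons_range_succ, Fin.cons_zero] at h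

include hϖ hϖ2 hF hdown in
/-- **`ϖ·y ∈ (F) ⇒ y ∈ (F)`**: `ϖ` is regular modulo `(F₁,…,F_c)` (ring-level form; the stalk-level input of the flatness
criterion of part 2). [cite: Matsumura1987, Thm. 14.2 with Thm. 14.3] -/
theorem mem_span_range_of_mul_mem (y : R) (hy : ϖ * y ∈ Ideal.span (Set.range F)) : y ∈ Ideal.span (Set.range F) := by
  have h := mem_span_image_of_mul_mem_of_linearIndependent_toCotangent _ (cons_mem_maximalIdeal hϖ hF)
    (linearIndependent_toCotangent_cons hϖ hϖ2 hF hdown) 0 (Set.range Fin.succ)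
    (by rintro ⟨j, hj⟩; exact Fin.succ_ne_zero j hj) y
  rw [image_cons_range_succ, Fin.cons_zero] at h
  exact h hy

include hϖ hϖ2 hF hdown in
/-- **`ϖ` is a NON-ZERO-DIVISOR of `S/(F₁,…,F_c)`** — at the point, the nose is FLAT over the discrete valuation ring of which
`ϖ` is the uniformiser (torsion-free ⇒ flat). [cite: Matsumura1987, Thm. 14.2 with Thm. 14.3] -/
theorem mk_mem_nonZeroDivisors_of_cons :
    Ideal.Quotient.mk (Ideal.span (Set.range F)) ϖ ∈ nonZeroDivisors (R ⧸ Ideal.span (Set.range F)) := by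
  refine mem_nonZeroDivisors_iff_right.mpr fun r hr => ?_
  obtain ⟨y, rfl⟩ := Ideal.Quotient.mk_surjective r
  rw [Ideal.Quotient.eq_zero_iff_mem]
  rw [← map_mul, Ideal.Quotient.eq_zero_iff_mem, mul_comm] at hr
  exact mem_span_range_of_mul_mem hϖ hϖ2 hF hdown y hr

include hϖ hϖ2 hF hdown in
/-- The same as `IsSMulRegular`. [cite: Matsumura1987, Thm. 14.2 with Thm. 14.3] -/
theorem isSMulRegular_quotient_of_cons : IsSMulRegular (R ⧸ Ideal.span (Set.range F)) ϖ := by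
  intro r r' h
  have hϖr := mk_mem_nonZeroDivisors_of_cons hϖ hϖ2 hF hdown
  have h' : Ideal.Quotient.mk (Ideal.span (Set.range F)) ϖ * r = Ideal.Quotient.mk (Ideal.span (Set.range F)) ϖ * r' := by
    simpa [Algebra.smul_def] using h
  exact (mul_cancel_left_mem_nonZeroDivisors hϖr).mp h'

end RegularCons

/-! ## §3 Supplying the downstairs hypothesis -/

/-- **Transport of the downstairs hypothesis along a local surjection killing `ϖ`** (`q : S ↠ A`, e.g. `A = S/ϖS ≅ k[y]_𝔭`): if
`Σ bᵢ q(Fᵢ) ∈ 𝔪_A²` forces all `bᵢ ∈ 𝔪_A`, then `Σ aᵢ Fᵢ ∈ 𝔪_S² + (ϖ)` forces all `aᵢ ∈ 𝔪_S`. [folklore] -/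
theorem downstairs_of_surjective {A : Type v} [CommRing A] [IsLocalRing A] (q : S →+* A) (hq : Function.Surjective q)
    {c : ℕ} {ϖ : S} (hqϖ : q ϖ = 0) {F : Fin c → S}
    (hA : ∀ b : Fin c → A, ∑ i, b i * q (F i) ∈ maximalIdeal A ^ 2 → ∀ i, b i ∈ maximalIdeal A) :
    ∀ a : Fin c → S, ∑ i, a i * F i ∈ maximalIdeal S ^ 2 ⊔ Ideal.span {ϖ} → ∀ i, a i ∈ maximalIdeal S := by
  haveI : IsLocalHom q := IsLocalHom.of_surjective _ hq
  intro a ha i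
  have hmle : (maximalIdeal S).map q ≤ maximalIdeal A :=
    Ideal.map_le_iff_le_comap.mpr fun x hx => map_nonunit q x hx
  have hmap : ∀ x ∈ maximalIdeal S ^ 2 ⊔ Ideal.span {ϖ}, q x ∈ maximalIdeal A ^ 2 := by
    intro x hx
    obtain ⟨y, hy, z, hz, rfl⟩ := Submodule.mem_sup.mp hx
    obtain ⟨t, rfl⟩ := Ideal.mem_span_singleton'.mp hz
    rw [map_add, map_mul, hqϖ, mul_zero, add_zero]
    have h := Ideal.mem_map_of_mem q hy
    rw [Ideal.map_pow] at h
    exact Ideal.pow_right_mono hmle 2 h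
  have hq' : ∑ i, q (a i) * q (F i) ∈ maximalIdeal A ^ 2 := by
    have h := hmap _ ha
    simpa [map_sum, map_mul] using h
  have h := hA (fun i => q (a i)) hq' i
  by_contra hai
  have hu : IsUnit (a i) := by simpa [mem_maximalIdeal, mem_nonunits_iff] using hai
  exact (mem_maximalIdeal _).mp h (hu.map q)

/-- **The Jacobian-minor supply** (Matsumura 30.4 (ii), key step, tree `coeff_mem_maximalIdeal_of_sum_mul_mem_sq`): for a prime
`P` of a ring `R`, `A = R_P`, `f₁,…,f_c ∈ P` and derivations `D₁,…,D_c` of `R` with `det(Dᵢ fⱼ) ∉ P`, the downstairs hypothesis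
holds for the images of the `fⱼ` in `A`. [cite: Matsumura1987, Thm. 30.4 (ii)] -/
theorem downstairs_of_jacobian {R : Type u} [CommRing R] (P : Ideal R) [P.IsPrime] (A : Type u) [CommRing A] [Algebra R A]
    [IsLocalization.AtPrime A P] [IsLocalRing A] {c : ℕ} (D : Fin c → Derivation ℤ R R) (f : Fin c → R)
    (hf : ∀ j, f j ∈ P) (hdet : (Matrix.of fun i j => D i (f j)).det ∉ P) :
    ∀ b : Fin c → A, ∑ j, b j * algebraMap R A (f j) ∈ maximalIdeal A ^ 2 → ∀ j, b j ∈ maximalIdeal A :=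
  fun b hb j => coeff_mem_maximalIdeal_of_sum_mul_mem_sq P A D f hf hdet b hb j

end CILift

end Summit.ResolutionOfSingularities.ResolutionOfSingularities.Cruxes.EquisingularLiftNat.Sections

end
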